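import Mathlib
import Literature.Analysis.FluidPDE.Tao2016AveragedNS.ShiftSetCascadeFlows
import Literature.Analysis.FluidPDE.Tao2016AveragedNS.ShiftSetCascadeFlux
import Summits.NavierStokesRegularity.NavierStokesRegularity.Theorems.TaoLadderRungTwoFlatCertificateGlueCheckerChainVectorOn
import Summits.NavierStokesRegularity.NavierStokesRegularity.Theorems.TaoLadderRungTwoFlatCertificateGlueLohnerVectorRowOn
import HarnessLib

/-!
# Certificate glue on a shift set `𝕊`, XXV-l / XXVII-d: THE PER-ROW E-RECURSION TEST AND THE VECTOR-LAYOUT STEP CHECKER WITH PER-ROW REMAINDER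
  FACTORS — `checkERecVR` (`dP_c + κ_c + NVE_c + bRowSum_c · m'² h (b m' h)^p/(1 − b m' h) ≤ E'_c`, `m' = m_C + ρ_s`), its soundness, the row
  constants `|PQcN(y,z)_c| ≤ bRowSum_c N_y N_z` from the coefficient boxes, and `stepCert_of_checksVR` / `stepCert_of_recVR` = glue XXVII-c /
  XXVIII-c with glue XIX-i `stepCert_of_plohner_mvr` underneath (helper for items stmt-NavierStokesRegularity-22987 `FlatGapCertificatesV2` (crux K_A♭ of
  route TaoLadderRungTwoFlat) and stmt-24295 K_A₂(64); cell harvest/h2-tao-ladder, p1 g16; theory-1 F-24 / layout V «β_c·S_Q»)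

The step record is glue XXVIII-c's `VRec` unchanged (the row constants are recomputed from the coefficient boxes, no new data); only the E-recursion
test differs from `stepCert_of_recV` (uniform remainder `remQ p b (m_C+ρ_s) h` there, `bRowSum_c · remRowQ p b (m_C+ρ_s) h` here; since the
(B)-table test gives `bRowSum_c ≤ b`, the row form is never weaker).

HONEST FRAMING: Tao-type MODEL lattices (Tao 2016 §4/§6 vocabulary, shift-set parametrised); soundness of a checker — NO certificate instance exists
in the tree, nothing is certified here, no stub is closed, nothing here is a statement about the Navier–Stokes equations.
-/

-- the sub-problem namespace repeats the summit name by design (D-0017)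
set_option linter.dupNamespace false

namespace Summit.NavierStokesRegularity.NavierStokesRegularity.Theorems

open Set Finset Literature.Analysis.FluidPDE Literature.Analysis.FluidPDE.TaoCascade
open Summit.NavierStokesRegularity.NavierStokesRegularity.Theorems.TaylorModelCert
open Summit.NavierStokesRegularity.NavierStokesRegularity.Theorems.TaylorModelReadout

namespace CertificateGlueOn

variable {m : ℕ} {Kb Ka : ℤ}

/-! ### Index bookkeeping: a flat coordinate and its window pair -/

/-- The array index of a flat coordinate `d ↔ (i, k)` is `(k + Kb) + W·i`. [folklore] -/
theorem val_eq_of_symm (d : Fin (m * winLen Kb Ka)) :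
    (shellAt Kb (finProdFinEquiv.symm d).2 + Kb).toNat + winLen Kb Ka * ((finProdFinEquiv.symm d).1 : ℕ) = (d : ℕ) := by
  have e1 : (shellAt Kb (finProdFinEquiv.symm d).2 + Kb).toNat = ((finProdFinEquiv.symm d).2 : ℕ) := by
    simp only [shellAt, sub_add_cancel, Int.toNat_natCast]
  rw [e1]
  conv_rhs => rw [← finProdFinEquiv.apply_symm_apply d]
  rw [finProdFinEquiv_apply_val]

/-! ### The row constants from the coefficient boxes (bilinear form) -/

variable {ω : Fin m → ℤ → ℝ} {ε₀ : ℝ} {α : Fin m → Fin m → Fin m → ℤ × ℤ × ℤ → ℝ}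
  {shifts : List (ℤ × ℤ × ℤ)} {coefB : Fin m → ℤ → Fin m → Fin m → ℤ × ℤ × ℤ → IntervalD}

/-- **Row constants, bilinear form**: `|PQcN y z|_d ≤ bRowSum_{(i,k)} · N_y · N_z` for `|y| ≤ N_y`, `|z| ≤ N_z`, `d ↔ (i,k)` — the hypothesis `hBrow` of
glue XIX-i with `brow d := (bRowSum … (i,k)).toReal`. [folklore] -/
theorem hBrow2_of_coefBox (hKb : 0 ≤ Kb) (hKa : 1 ≤ Ka) (hω : ∀ i k, 0 < ω i k) (hε : 0 < 1 + ε₀) (hnd : shifts.Nodup)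
    (hcoef : CoefBoxOK shifts ε₀ α Kb Ka ω coefB) :
    ∀ (y z : Fin (m * winLen Kb Ka) → ℝ) (Ny Nz : ℝ), 0 ≤ Ny → 0 ≤ Nz → (∀ d, |y d| ≤ Ny) → (∀ d, |z d| ≤ Nz) → ∀ d,
      |PQcN shifts.toFinset ε₀ α Kb Ka ω y z d| ≤
        (bRowSum Kb Ka shifts coefB (finProdFinEquiv.symm d).1 (shellAt Kb (finProdFinEquiv.symm d).2)).toReal * Ny * Nz := by
  intro y z Ny Nz hNy hNz hy hz d
  have hKK : 0 ≤ Ka + Kb + 1 := by omega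
  obtain ⟨hk1, hk2⟩ := shellAt_mem hKK (finProdFinEquiv.symm d).2
  have hrow := pqcN_row_bound (𝕊 := shifts.toFinset) (ε₀ := ε₀) (α := α) hε hω hKK y z hNy hy hz d
  have htab := rowTabR_le_bRowSum (ε₀ := ε₀) (α := α) hω hε hnd hcoef (finProdFinEquiv.symm d).1 hk1 hk2
  have hωk := hω (finProdFinEquiv.symm d).1 (shellAt Kb (finProdFinEquiv.symm d).2)
  set W := ω (finProdFinEquiv.symm d).1 (shellAt Kb (finProdFinEquiv.symm d).2)
  set B := (bRowSum Kb Ka shifts coefB (finProdFinEquiv.symm d).1 (shellAt Kb (finProdFinEquiv.symm d).2)).toReal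
  set P := |PQcN shifts.toFinset ε₀ α Kb Ka ω y z d|
  have hNN : 0 ≤ Ny * Nz := mul_nonneg hNy hNz
  have h1 : P * W ≤ W * (B * Ny * Nz) := by
    calc P * W ≤ rowTabR shifts.toFinset ε₀ α Kb Ka ω (finProdFinEquiv.symm d).1 (shellAt Kb (finProdFinEquiv.symm d).2) * Ny * Nz := hrow
      _ ≤ W * B * Ny * Nz := by nlinarith [htab, hNN]
      _ = W * (B * Ny * Nz) := by ring
  by_contra hcon
  push Not at hcon
  have : W * (B * Ny * Nz) < P * W := by nlinarith [mul_lt_mul_of_pos_left hcon hωk]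
  linarith

/-! ### C8vr: the per-component E-recursion with per-row remainder factors -/

/-- Rational core of the per-row remainder: `m'² h (b m' h)^p / (1 − b m' h)`. [folklore] -/
def remRowQ (p : ℕ) (b m' h : ℚ) : ℚ := m' ^ 2 * h * (b * m' * h) ^ p / (1 - b * m' * h)

/-- **The C8vr test**: `dP_c + κ_c + NVE_c + bRowSum_c · remRowQ p b (mC + ρs) h ≤ E'_c` at every window coordinate `c = idx(i,k)`, exactly. [folklore] -/
def checkERecVR (m : ℕ) (Kb Ka : ℤ) (shifts : List (ℤ × ℤ × ℤ)) (coefB : Fin m → ℤ → Fin m → Fin m → ℤ × ℤ × ℤ → IntervalD) (p : ℕ)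
    (b mC ρs h : ℚ) (dPA κA nveA E1D : Array Dyad) : Bool :=
  (List.finRange m).all fun i => (List.range (winLen Kb Ka)).all fun cc =>
    let c := cc + winLen Kb Ka * i.val
    decide (dyadToRat (dgetD dPA c) + dyadToRat (dgetD κA c) + dyadToRat (dgetD nveA c) +
      dyadToRat (bRowSum Kb Ka shifts coefB i ((cc : ℤ) - Kb)) * remRowQ p b (mC + ρs) h ≤ dyadToRat (dgetD E1D c))

/-- **C8vr FROM THE TEST**: the per-component E-recursion `hE₁` of glue XIX-i for the cast data. [folklore] -/
theorem eRecVR_of_check {shifts : List (ℤ × ℤ × ℤ)} {coefB : Fin m → ℤ → Fin m → Fin m → ℤ × ℤ × ℤ → IntervalD} {p : ℕ} {b mC ρs h : ℚ}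
    {dPA κA nveA E1D : Array Dyad} (hc : checkERecVR m Kb Ka shifts coefB p b mC ρs h dPA κA nveA E1D = true) (hKK : 0 ≤ Ka + Kb + 1) :
    ∀ c : Fin (m * winLen Kb Ka), (dgetD dPA c).toReal + (dgetD κA c).toReal + (dgetD nveA c).toReal +
      (bRowSum Kb Ka shifts coefB (finProdFinEquiv.symm c).1 (shellAt Kb (finProdFinEquiv.symm c).2)).toReal *
        (((mC : ℝ) + (ρs : ℝ)) ^ 2 * (h : ℝ) * ((b : ℝ) * ((mC : ℝ) + (ρs : ℝ)) * (h : ℝ)) ^ p /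
          (1 - (b : ℝ) * ((mC : ℝ) + (ρs : ℝ)) * (h : ℝ))) ≤
      dvec (n := m * winLen Kb Ka) E1D c := by
  intro c
  simp only [checkERecVR, List.all_eq_true, List.mem_finRange, List.mem_range, decide_eq_true_eq, true_implies] at hc
  have hval := val_eq_of_symm c
  have hkm := shellAt_mem hKK (finProdFinEquiv.symm c).2
  set k := shellAt Kb (finProdFinEquiv.symm c).2 with hk
  obtain ⟨hk1, hk2⟩ := hkm
  have hcc : (k + Kb).toNat < winLen Kb Ka := by
    unfold winLen; rw [Int.toNat_lt_toNat (by omega)]; omega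
  have h1 := hc (finProdFinEquiv.symm c).1 (k + Kb).toNat hcc
  rw [Int.toNat_of_nonneg (by omega), show k + Kb - Kb = k by ring, hval] at h1
  have h2 := (Rat.cast_le (K := ℝ)).mpr h1
  simp only [Rat.cast_add, Rat.cast_mul, cast_dyadToRat, remRowQ, Rat.cast_div, Rat.cast_pow, Rat.cast_sub, Rat.cast_one] at h2
  simpa [dvec] using h2

/-! ### XXVII-d: the step checker with per-row remainder factors -/

/-- **THE VECTOR-LAYOUT STEP CHECKER WITH PER-ROW REMAINDER FACTORS IS SOUND** (glue XXVII-c `stepCert_of_checksV` with `checkERecV` replaced by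
`checkERecVR`; glue XIX-i underneath). [cite: Zgliczynski2002C1Lohner, §3–4 (Lohner-type parallelepiped frames and the C¹/variational enclosure); cell certificate format, Lohner step, vector remainder] -/
theorem stepCert_of_checksVR (hKb : 0 ≤ Kb) (hKa : 1 ≤ Ka) {shifts : List (ℤ × ℤ × ℤ)} (hnd : shifts.Nodup)
    (h𝕊 : IsNearestNeighbourSet shifts.toFinset) {q : ℚ} (hq : 0 < 1 + (q : ℝ))
    {αq : Fin m → Fin m → Fin m → ℤ × ℤ × ℤ → ℚ} {ωq : Fin m → ℤ → ℚ} (hω : ∀ i k, 0 < ωq i k)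
    {prec p kexp nexp : ℕ} {Sp Sm : IntervalD} (hSp : sqrtCheck prec (1 + q) Sp = true)
    (hSm : sqrtCheck prec (1 / (1 + q)) Sm = true)
    {M : ℤ → ℝ} {t : ℕ → ℝ} {Node Hull : ℕ → (Fin m → ℤ → ℝ) → Prop} {j : ℕ}
    {xD x'D rD r'D ρD ED E1D loD hiD : Array Dyad} {C Cn T : Array (Array Dyad)} {bD mC ρs δD : Dyad}
    {K A A' Eb Et h : ℚ}
    (hb : 0 ≤ bD.toReal) (hmC : 0 ≤ mC.toReal) (hρs : 0 ≤ ρs.toReal) (hAA' : A < A') (ht : t (j + 1) - t j = (h : ℝ))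
    (hchkB : checkB m Kb Ka shifts (coefBoxOf prec αq ωq Sp Sm) bD = true)
    (h2 : checkAbsLe (m * winLen Kb Ka) xD mC = true)
    (h3 : checkRowsLe (m * winLen Kb Ka) C rD ρD = true)
    (hhull : checkHull (m * winLen Kb Ka) ρD ED ρs = true)
    (h6 : checkRowsLe (m * winLen Kb Ka) T rD r'D = true)
    (h8 : checkERecVR m Kb Ka shifts (coefBoxOf prec αq ωq Sp Sm) p (dyadToRat bD) (dyadToRat mC) (dyadToRat ρs) h
      (dPArr (m * winLen Kb Ka) prec (IntervalD.polyLevelsA (m * winLen Kb Ka) prec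
        (IntervalD.jetLevelsA (m * winLen Kb Ka) (pqBoxA Kb Ka prec shifts (coefBoxOf prec αq ωq Sp Sm)) prec
          (pointBoxA (m * winLen Kb Ka) xD) p) p (ofRatRel prec h)) x'D)
      (kappaArr prec (m * winLen Kb Ka) Cn T
        (vcolsA Kb Ka prec shifts (coefBoxOf prec αq ωq Sp Sm) p
          (IntervalD.jetLevelsA (m * winLen Kb Ka) (pqBoxA Kb Ka prec shifts (coefBoxOf prec αq ωq Sp Sm)) prec
            (hullBoxA (m * winLen Kb Ka) xD ρD ED) p) (ofRatRel prec h) C) rD)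
      (nveArr (m * winLen Kb Ka) (IntervalD.polyLevelsA (m * winLen Kb Ka) prec
        (IntervalD.varJetLevelsA (m * winLen Kb Ka) (pqBoxA Kb Ka prec shifts (coefBoxOf prec αq ωq Sp Sm)) prec
          (IntervalD.jetLevelsA (m * winLen Kb Ka) (pqBoxA Kb Ka prec shifts (coefBoxOf prec αq ωq Sp Sm)) prec
            (hullBoxA (m * winLen Kb Ka) xD ρD ED) p) (symBoxA (m * winLen Kb Ka) ED) p) p (ofRatRel prec h)))
      E1D = true)
    (h9 : checkGuardV (dyadToRat bD) (dyadToRat mC) (dyadToRat ρs) h = true)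
    (h13 : checkCoverV m Kb Ka shifts (coefBoxOf prec αq ωq Sp Sm) xD ρD ED loD hiD h A' = true)
    (h10 : checkLipT m Kb Ka shifts (coefBoxOf prec αq ωq Sp Sm) loD hiD K = true)
    (h11 : checkDefectT m Kb Ka prec shifts αq ωq Eb Et loD hiD Sp Sm δD = true)
    (h12 : checkGronwallK K (dyadToRat δD) h A kexp nexp = true)
    (hN : ∀ y, Node j y → PInParaV Kb Ka (fun i k => (ωq i k : ℝ)) (dvec (n := m * winLen Kb Ka) xD)
      (dmat (n := m * winLen Kb Ka) C) (dvec (n := m * winLen Kb Ka) rD) (dvec (n := m * winLen Kb Ka) ED) y)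
    (hH : ∀ u ∈ Icc 0 (h : ℝ), ∀ y q' : Fin m → ℤ → ℝ,
      ProdTube Kb Ka (fun i k => (ωq i k : ℝ)) (dvec (n := m * winLen Kb Ka) xD) (dvec (n := m * winLen Kb Ka) ρD)
        (dvec (n := m * winLen Kb Ka) ED) (vOf Kb Ka shifts (coefBoxOf prec αq ωq Sp Sm) loD hiD) u q' →
      (∀ i k, -Kb ≤ k → k ≤ Ka → |y i k - q' i k| ≤ (A : ℝ) * (ωq i k : ℝ)) → Hull j y)
    (hN' : ∀ y, PInParaV Kb Ka (fun i k => (ωq i k : ℝ)) (dvec (n := m * winLen Kb Ka) x'D)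
      (dmat (n := m * winLen Kb Ka) Cn) (dvec (n := m * winLen Kb Ka) r'D) (fun c => dvec (n := m * winLen Kb Ka) E1D c + (A : ℝ)) y →
      Node (j + 1) y) :
    StepCert shifts.toFinset (q : ℝ) (fun i₁ i₂ i μ => (αq i₁ i₂ i μ : ℝ)) Kb Ka (Eb : ℝ) (Et : ℝ) M t Node Hull j := by
  have hcoef := coefBoxOK_coefBoxOf (Kb := Kb) (Ka := Ka) prec hq αq ωq hSp hSm shifts
  have hω' : ∀ i k, (0 : ℝ) < (ωq i k : ℝ) := fun i k => by exact_mod_cast hω i k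
  have hKK : 0 ≤ Ka + Kb + 1 := by omega
  have hX : (pointBoxA (m * winLen Kb Ka) xD).size = m * winLen Kb Ka := by simp [pointBoxA]
  have hx := mem_pointBoxA (m * winLen Kb Ka) xD
  have hhmem : IntervalD.mem (t (j + 1) - t j) (ofRatRel prec h) := by rw [ht]; exact mem_ofRatRel prec h
  have hg := guardV_of_check h9
  have hgr := gronwallK_of_check h12
  have hKδ := nonneg_of_checkGronwallK h12
  have hE := eRecVR_of_check h8 hKK
  simp only [cast_dyadToRat] at hg hgr hKδ hE
  have hAA'r : (A : ℝ) < (A' : ℝ) := by exact_mod_cast hAA'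
  have hA0 : (0 : ℝ) ≤ (A : ℝ) := (gronwallBound_nonneg_of_zero hKδ.2 hg.1).trans hgr
  have hA' : 0 < A' := by
    have : (0 : ℝ) < (A' : ℝ) := hA0.trans_lt hAA'r
    exact_mod_cast this
  refine stepCert_of_plohner_mvr (ω := fun i k => (ωq i k : ℝ)) (p := p) hKb hKa hq hω' hb hmC hρs hKδ.1 hKδ.2 hAA'r
    (by rw [ht]; exact hg.1) (by rw [ht]; exact hg.2) (hB_of_checkB hKb hKa hω' hq hnd hcoef hchkB)
    (hBrow2_of_coefBox hKb hKa hω' hq hnd hcoef)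
    (abs_le_of_checkAbsLe h2) (mulVec_le_of_checkRowsLe h3) (hull_le_of_checkHull hhull)
    (abs_TPoly_sub_le_dPArr hKb hKa hnd hcoef p hX hx hhmem x'D)
    (kappa_of_kappaArr hKb hKa hnd hcoef p xD ρD ED hhmem C Cn T rD)
    (abs_VPoly_le_nveArr hKb hKa hnd hcoef p xD ρD ED hhmem)
    (mulVec_le_of_checkRowsLe h6) (fun c => by rw [ht]; exact hE c)
    (pqcN_prod_bound hKb hKa hω' hq hnd hcoef loD hiD)
    (fun c => vRowSum_nonneg hnd loD hiD _ _)
    (fun c => by rw [ht]; exact hG_of_checkCoverV hnd hA' h13 hKK c)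
    (fun u hu q' y hq' hnear => inBox_of_checkCoverV hnd hω h13 (by rwa [ht] at hu) hq' hnear)
    (pfieldLip_of_checkLipT hKb hKa hω' hq hcoef h10)
    (pinputDefect_of_checkDefectT prec hnd h𝕊 hq hω hSp hSm h11) (by rw [ht]; exact hgr) hN
    (fun u hu y q' hq' hnear => hH u (by rwa [ht] at hu) y q' hq' hnear) hN'

/-! ### XXVIII-d: the chain step with per-row remainder factors -/

/-- **`StepCert j` OF THE DEFINITIONAL MESH (VECTOR LAYOUT, PER-ROW REMAINDER) FROM THE TESTS OF RECORD `j` AND THE HAND-OVER TO RECORD `j+1`.**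
[cite: Zgliczynski2002C1Lohner, §3–4 (Lohner-type parallelepiped frames and the C¹/variational enclosure); cell certificate format, chain checker, vector remainder] -/
theorem stepCert_of_recVR (hKb : 0 ≤ Kb) (hKa : 1 ≤ Ka) {shifts : List (ℤ × ℤ × ℤ)} (hnd : shifts.Nodup)
    (h𝕊 : IsNearestNeighbourSet shifts.toFinset) {q : ℚ} (hq : 0 < 1 + (q : ℝ))
    {αq : Fin m → Fin m → Fin m → ℤ × ℤ × ℤ → ℚ} {ωq : Fin m → ℤ → ℚ} (hω : ∀ i k, 0 < ωq i k)
    {prec p kexp nexp : ℕ} {Sp Sm : IntervalD} (hSp : sqrtCheck prec (1 + q) Sp = true)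
    (hSm : sqrtCheck prec (1 / (1 + q)) Sm = true) {M : ℤ → ℝ} {t : ℕ → ℝ} {rec : ℕ → VRec} {j : ℕ}
    {bD : Dyad} {Eb Et : ℚ}
    (hb : 0 ≤ bD.toReal) (hmC : 0 ≤ (rec j).mC.toReal) (hρs : 0 ≤ (rec j).ρs.toReal)
    (hAA' : (rec j).A < (rec j).A') (ht : t (j + 1) - t j = ((rec j).h : ℝ))
    (hnext : checkHandsOverV (m * winLen Kb Ka) (rec j) (rec (j + 1)) = true)
    (hchkB : checkB m Kb Ka shifts (coefBoxOf prec αq ωq Sp Sm) bD = true)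
    (h2 : checkAbsLe (m * winLen Kb Ka) (rec j).x (rec j).mC = true)
    (h3 : checkRowsLe (m * winLen Kb Ka) (rec j).C (rec j).r (rec j).ρ = true)
    (hhull : checkHull (m * winLen Kb Ka) (rec j).ρ (rec j).E (rec j).ρs = true)
    (h6 : checkRowsLe (m * winLen Kb Ka) (rec j).T (rec j).r (rec j).r' = true)
    (h8 : checkERecVR m Kb Ka shifts (coefBoxOf prec αq ωq Sp Sm) p (dyadToRat bD) (dyadToRat (rec j).mC) (dyadToRat (rec j).ρs) (rec j).h
      (dPArr (m * winLen Kb Ka) prec (IntervalD.polyLevelsA (m * winLen Kb Ka) prec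
        (IntervalD.jetLevelsA (m * winLen Kb Ka) (pqBoxA Kb Ka prec shifts (coefBoxOf prec αq ωq Sp Sm)) prec
          (pointBoxA (m * winLen Kb Ka) (rec j).x) p) p (ofRatRel prec (rec j).h)) (rec j).x')
      (kappaArr prec (m * winLen Kb Ka) (rec j).Cn (rec j).T
        (vcolsA Kb Ka prec shifts (coefBoxOf prec αq ωq Sp Sm) p
          (IntervalD.jetLevelsA (m * winLen Kb Ka) (pqBoxA Kb Ka prec shifts (coefBoxOf prec αq ωq Sp Sm)) prec
            (hullBoxA (m * winLen Kb Ka) (rec j).x (rec j).ρ (rec j).E) p) (ofRatRel prec (rec j).h) (rec j).C) (rec j).r)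
      (nveArr (m * winLen Kb Ka) (IntervalD.polyLevelsA (m * winLen Kb Ka) prec
        (IntervalD.varJetLevelsA (m * winLen Kb Ka) (pqBoxA Kb Ka prec shifts (coefBoxOf prec αq ωq Sp Sm)) prec
          (IntervalD.jetLevelsA (m * winLen Kb Ka) (pqBoxA Kb Ka prec shifts (coefBoxOf prec αq ωq Sp Sm)) prec
            (hullBoxA (m * winLen Kb Ka) (rec j).x (rec j).ρ (rec j).E) p) (symBoxA (m * winLen Kb Ka) (rec j).E) p) p
          (ofRatRel prec (rec j).h)))
      (rec j).E1 = true)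
    (h9 : checkGuardV (dyadToRat bD) (dyadToRat (rec j).mC) (dyadToRat (rec j).ρs) (rec j).h = true)
    (h13 : checkCoverV m Kb Ka shifts (coefBoxOf prec αq ωq Sp Sm) (rec j).x (rec j).ρ (rec j).E (rec j).lo (rec j).hi (rec j).h
      (rec j).A' = true)
    (h10 : checkLipT m Kb Ka shifts (coefBoxOf prec αq ωq Sp Sm) (rec j).lo (rec j).hi (rec j).K = true)
    (h11 : checkDefectT m Kb Ka prec shifts αq ωq Eb Et (rec j).lo (rec j).hi Sp Sm (rec j).δ = true)
    (h12 : checkGronwallK (rec j).K (dyadToRat (rec j).δ) (rec j).h (rec j).A kexp nexp = true) :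
    StepCert shifts.toFinset (q : ℝ) (fun i₁ i₂ i μ => (αq i₁ i₂ i μ : ℝ)) Kb Ka (Eb : ℝ) (Et : ℝ) M t
      (nodeOfV Kb Ka ωq rec) (hullOfV Kb Ka shifts αq ωq prec Sp Sm rec) j :=
  stepCert_of_checksVR hKb hKa hnd h𝕊 hq hω hSp hSm hb hmC hρs hAA' ht hchkB h2 h3 hhull h6 h8 h9 h13 h10 h11 h12 (fun _ hy => hy)
    (fun u hu _ q' hq' hnear => ⟨u, hu, q', hq', hnear⟩) (fun _ hy => node_of_checkHandsOverV hnext hy)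

end CertificateGlueOn

end Summit.NavierStokesRegularity.NavierStokesRegularity.Theorems
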